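import Literature.AlgebraicGeometry.RelativeSpec.FiniteGroupQuotientGluing
import Literature.AlgebraicGeometry.RelativeSpec.SymmetricPower
import HarnessLib

/-!
# Symmetric powers `X⁽ⁿ⁾_Y = Xⁿ_Y/𝔖ₙ` beyond the affine case (Milne, *Jacobian Varieties*, §3,
# Prop. 3.1 and the proof of Prop. 3.2; Mumford, *Abelian Varieties*, §7, Theorem p. 66)

Milne, *Jacobian Varieties*, §3: "the symmetric group `S_r` acts on `Cʳ` … and the quotient
`C^{(r)} = Cʳ/S_r` exists as a variety" (Prop. 3.1), the existence resting on Mumford's theorem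
(AV §7, p. 66) whose hypothesis — every orbit lies in an affine open — holds because "any finite
set of points of a quasi-projective variety is contained in an open affine" (proof of Prop. 3.2).
`…RelativeSpec.SymmetricPower` constructs `symPow r n` for `r : X → Y` AFFINE;
`…RelativeSpec.FiniteGroupQuotientGluing` glues quotients of `G`-stable opens affine over the
base. This file puts the two together for a general separated `r : X → Y` over a separated `Y`:

* complements on glued quotients (`ActionOver.isIntegralHom_gluedMk`: `π : X → X/G` is
  integral; `ActionOver.isSeparated_gluedDesc`: the morphism `X/G → Z` induced by a separated
  invariant `X → Z` is separated — the range of its diagonal is the image of the closed range of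
  the diagonal of `X → Z` under the universally closed `π × π`);
* `isSeparated_powOver_base`, `universallyClosed_powOver_base`, `locallyOfFiniteType_powOver_base`,
  `isProper_powOver_base` — `Xⁿ_Y → Y` inherits these from `r`;
* `powOpen r n W = ⋂ᵢ prᵢ⁻¹ W ⊆ Xⁿ_Y` for an open `W ⊆ X`: `𝔖ₙ`-stable
  (`permAction_preimage_powOpen`) and isomorphic to the fibre product `Wⁿ_Y` (`powOpenIso`),
  hence affine over `Y` when `W` is (`isAffineHom_powOpen_ι_base`);
* `FiniteSubsetsInAffineOpens r` — Mumford's hypothesis in the form "every finite set of points of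
  `X` lies in an open affine over `Y`"; `exists_stableAffineOpen_mem` — then every point of `Xⁿ_Y`
  lies in the `𝔖ₙ`-stable open `Wⁿ_Y` affine over `Y`, `W ⊇` its coordinates;
* `symPowGlued r n` (`= (permAction r n).glued`) with `symPowGlued.mk : Xⁿ_Y → X⁽ⁿ⁾_Y`
  (symmetric, surjective, affine, fibres = `𝔖ₙ`-orbits: `permHom_symPowGlued_mk`,
  `mk_surjective`, `isAffineHom_mk`, `mk_eq_iff`), the **universal property**
  `symPowGlued.existsUnique_desc` / `desc` / `mk_desc` / `hom_ext` for symmetric morphisms to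
  separated schemes, and the structure map `symPowGlued.base : X⁽ⁿ⁾_Y → Y` (`mk_base`), which
  is separated (`isSeparated_base`, `isSeparated`), surjective resp. universally closed when
  `Xⁿ_Y → Y` resp. `r` is (`surjective_base`, `universallyClosed_base`).

The projective case over a field (`FiniteSubsetsInAffineOpens` by graded prime avoidance) is
`Literature.AlgebraicGeometry.Motives.symPowProj` (`Motives/SymmetricPowerProjective`). Everything
is proved; no named facts; the `def`s are constructions with bodies (D-0026).

Mathlib searched (pin): `WidePullback.lift/π_arrow/hom_ext`, `IsOpenImmersion.lift`,
`MorphismProperty.pullback_fst`, `MorphismProperty.pullbackMap`, `pullback.comp_diagonal`,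
`IsClosedImmersion.of_isPreimmersion`, `UniversallyClosed.of_comp_surjective` (used); Mathlib has no
symmetric powers of schemes.

## References

* J. S. Milne, *Jacobian Varieties*, in *Arithmetic Geometry* (Storrs 1984), Springer 1986,
  Ch. VII, §3, Prop. 3.1 and proof of Prop. 3.2 (p. 170 of the 2nd printing). [Milne1986JacobianVarieties]
* D. Mumford, *Abelian Varieties* (1970), §7, Theorem p. 66 and the Remark p. 69. [MumfordAV1970]
-/

noncomputable section

universe u

open CategoryTheory Limits AlgebraicGeometry

namespace Literature.AlgebraicGeometry.RelativeSpec

/-! ### Complements on glued quotients: `π` is integral; descended maps are separated -/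

namespace ActionOver

variable {X Y : Scheme.{u}} {r : X ⟶ Y} {G : Type*} [Group G] (ρ : ActionOver r G)
  [Finite G] [Y.IsSeparated] [IsSeparated r]
  (hcov : ∀ x : X, ∃ O : ρ.StableAffineOpens, x ∈ O.1)

/-- **`π : X → X/G` is integral** (hence universally closed): it is so over each chart `O/G`,
where it is the integral `O → O/G`. [cite: MumfordAV1970, §7 Thm. p. 66 (1)] -/
instance isIntegralHom_gluedMk : IsIntegralHom (ρ.gluedMk hcov) := by
  refine IsZariskiLocalAtTarget.of_openCover (Scheme.IsLocallyDirected.openCover ρ.glueFunctor)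
    fun O => ?_
  change IsIntegralHom (pullback.snd (ρ.gluedMk hcov) (ρ.gluedι O))
  rw [← (ρ.isPullback_chart hcov O).flip.isoPullback_inv_snd]
  haveI : IsIntegralHom (ρ.pieceMk O) := (ρ.restrict O.1 O.2.1).isIntegralHom_toQuotient
  infer_instance

include hcov in
set_option backward.isDefEq.respectTransparency false in
/-- **Morphisms descended from separated invariant morphisms are separated**: if `f : X → Z` is
`G`-invariant and separated then so is the induced `X/G → Z` — the diagonal of `X/G` has closed
range, being the image of the (closed) range of the diagonal of `f` under the universally closed
`π × π` (`π` surjective and integral). In particular `X/G → Y` is separated. [cite: MumfordAV1970, §7 Thm. p. 66; §12] -/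
theorem isSeparated_gluedDesc {Z : Scheme.{u}} [Z.IsSeparated] (f : X ⟶ Z)
    (hf : ∀ g : G, (ρ.aut g).hom ≫ f = f) [IsSeparated f] :
    IsSeparated (ρ.gluedDesc f hf) := by
  set q := ρ.gluedDesc f hf with hqdef
  let p := ρ.gluedMk hcov
  have hq : p ≫ q = f := ρ.gluedMk_gluedDesc hcov f hf
  haveI : IsSeparated (p ≫ q) := by rw [hq]; infer_instance
  haveI hUC : UniversallyClosed (pullback.map (p ≫ q) (p ≫ q) q q p p (𝟙 Z)
      ((Category.comp_id _).trans rfl) ((Category.comp_id _).trans rfl)) :=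
    MorphismProperty.pullbackMap (P := @UniversallyClosed) inferInstance inferInstance rfl rfl
  refine ⟨IsClosedImmersion.of_isPreimmersion _ ?_⟩
  have e1 : Set.range (pullback.diagonal q) = Set.range (p ≫ pullback.diagonal q) := by
    rw [Scheme.Hom.comp_base, TopCat.coe_comp, Set.range_comp, (ρ.gluedMk_surjective hcov).range_eq,
      Set.image_univ]
  rw [e1, pullback.comp_diagonal, Scheme.Hom.comp_base, TopCat.coe_comp, Set.range_comp]
  exact (Scheme.Hom.isClosedMap _) _ (pullback.diagonal (p ≫ q)).isClosedEmbedding.isClosed_range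

end ActionOver

variable {X Y : Scheme.{u}} (r : X ⟶ Y) (n : ℕ)

/-! ### `Xⁿ_Y → Y` is separated when `r` is -/

/-- **`Xⁿ_Y → Y` is separated** when `r` is (induction via `Xⁿ⁺¹_Y ≅ Xⁿ_Y ×_Y X`). [folklore] -/
instance isSeparated_powOver_base [IsSeparated r] : ∀ n, IsSeparated (powOver.base r n)
  | 0 => inferInstance
  | n + 1 => by
    haveI := isSeparated_powOver_base n
    rw [← powSuccIso_hom_fst_base]
    haveI : IsSeparated (pullback.fst (powOver.base r n) r) :=
      MorphismProperty.pullback_fst _ _ ‹IsSeparated r›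
    infer_instance

/-- **`Xⁿ_Y → Y` is universally closed** when `r` is. [folklore] -/
instance universallyClosed_powOver_base [UniversallyClosed r] : ∀ n, UniversallyClosed (powOver.base r n)
  | 0 => inferInstance
  | n + 1 => by
    haveI := universallyClosed_powOver_base n
    rw [← powSuccIso_hom_fst_base]
    haveI : UniversallyClosed (pullback.fst (powOver.base r n) r) :=
      MorphismProperty.pullback_fst _ _ ‹UniversallyClosed r›
    infer_instance

/-- **`Xⁿ_Y → Y` is locally of finite type** when `r` is. [folklore] -/
instance locallyOfFiniteType_powOver_base [LocallyOfFiniteType r] :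
    ∀ n, LocallyOfFiniteType (powOver.base r n)
  | 0 => inferInstance
  | n + 1 => by
    haveI := locallyOfFiniteType_powOver_base n
    rw [← powSuccIso_hom_fst_base]
    haveI : LocallyOfFiniteType (pullback.fst (powOver.base r n) r) :=
      MorphismProperty.pullback_fst _ _ ‹LocallyOfFiniteType r›
    infer_instance

/-- **`Xⁿ_Y → Y` is proper** when `r` is. [folklore] -/
instance isProper_powOver_base [IsProper r] : ∀ n, IsProper (powOver.base r n)
  | 0 => inferInstance
  | n + 1 => by
    haveI := isProper_powOver_base n
    rw [← powSuccIso_hom_fst_base]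
    haveI : IsProper (pullback.fst (powOver.base r n) r) :=
      MorphismProperty.pullback_fst _ _ ‹IsProper r›
    infer_instance

/-! ### The open `Wⁿ ⊆ Xⁿ_Y` of an open `W ⊆ X` -/

/-- The open `Wⁿ_Y = ⋂ᵢ prᵢ⁻¹ W ⊆ Xⁿ_Y` for an open `W ⊆ X` (a finite intersection). [folklore] -/
def powOpen (W : X.Opens) : (powOver r n).Opens :=
  ⟨⋂ i : Fin n, powOver.proj r n i ⁻¹' (W : Set X),
    isOpen_iInter_of_finite fun i => W.2.preimage (powOver.proj r n i).continuous⟩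

variable {r n}

/-- Membership in `Wⁿ_Y`: all coordinates lie in `W`. [folklore] -/
theorem mem_powOpen {W : X.Opens} {z : powOver r n} :
    z ∈ powOpen r n W ↔ ∀ i : Fin n, powOver.proj r n i z ∈ W :=
  Set.mem_iInter

/-- `Wⁿ_Y ⊆ prᵢ⁻¹ W`. [folklore] -/
theorem powOpen_le (W : X.Opens) (i : Fin n) : powOpen r n W ≤ powOver.proj r n i ⁻¹ᵁ W :=
  fun _ hz => mem_powOpen.mp hz i

variable (r n)

/-- `Wⁿ_Y` is stable under the permutations of the factors. [folklore] -/
theorem permHom_preimage_powOpen (σ : Equiv.Perm (Fin n)) (W : X.Opens) :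
    permHom r n σ ⁻¹ᵁ powOpen r n W = powOpen r n W := by
  ext z
  change permHom r n σ z ∈ powOpen r n W ↔ z ∈ powOpen r n W
  simp only [mem_powOpen, ← Scheme.Hom.comp_apply, permHom_proj]
  exact ⟨fun h i => by simpa using h (σ i), fun h i => h _⟩

/-- `Wⁿ_Y` is stable under the `𝔖ₙ`-action `permAction`. [folklore] -/
theorem permAction_preimage_powOpen (σ : Equiv.Perm (Fin n)) (W : X.Opens) :
    ((permAction r n).aut σ).hom ⁻¹ᵁ powOpen r n W = powOpen r n W := by
  rw [permAction_aut_hom, permHom_preimage_powOpen]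

/-- The coordinate maps `Wⁿ_Y → W`. [folklore] -/
def powOpenProj (W : X.Opens) (i : Fin n) : (powOpen r n W : Scheme.{u}) ⟶ W :=
  IsOpenImmersion.lift W.ι ((powOpen r n W).ι ≫ powOver.proj r n i) (by
    rintro _ ⟨z, rfl⟩
    rw [Scheme.Opens.range_ι]
    exact mem_powOpen.mp z.2 i)

/-- `(Wⁿ_Y → W) ≫ (W ↪ X) = (Wⁿ_Y ↪ Xⁿ_Y) ≫ prᵢ`. [folklore] -/
@[reassoc (attr := simp)]
theorem powOpenProj_ι (W : X.Opens) (i : Fin n) :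
    powOpenProj r n W i ≫ W.ι = (powOpen r n W).ι ≫ powOver.proj r n i :=
  IsOpenImmersion.lift_fac _ _ _

/-- The comparison `Wⁿ_Y (open of Xⁿ_Y) → (W)ⁿ_Y (wide pullback of the W's)`. [folklore] -/
def powOpenToPowOver (W : X.Opens) : (powOpen r n W : Scheme.{u}) ⟶ powOver (W.ι ≫ r) n :=
  WidePullback.lift ((powOpen r n W).ι ≫ powOver.base r n) (powOpenProj r n W)
    fun i => by
      rw [powOpenProj_ι_assoc]
      exact congrArg ((powOpen r n W).ι ≫ ·) (WidePullback.π_arrow (fun _ : Fin n => r) i)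

/-- The comparison commutes with the projections. [folklore] -/
@[reassoc (attr := simp)]
theorem powOpenToPowOver_proj (W : X.Opens) (i : Fin n) :
    powOpenToPowOver r n W ≫ powOver.proj (W.ι ≫ r) n i = powOpenProj r n W i :=
  WidePullback.lift_π _ _ _ _ _

/-- The comparison commutes with the structure maps. [folklore] -/
@[reassoc (attr := simp)]
theorem powOpenToPowOver_base (W : X.Opens) :
    powOpenToPowOver r n W ≫ powOver.base (W.ι ≫ r) n = (powOpen r n W).ι ≫ powOver.base r n :=
  WidePullback.lift_base _ _ _ _

/-- The map `(W)ⁿ_Y → Xⁿ_Y` induced by `W ↪ X`. [folklore] -/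
def powOverOfOpen (W : X.Opens) : powOver (W.ι ≫ r) n ⟶ powOver r n :=
  WidePullback.lift (powOver.base (W.ι ≫ r) n) (fun i => powOver.proj (W.ι ≫ r) n i ≫ W.ι)
    fun i => by
      rw [Category.assoc]
      exact WidePullback.π_arrow (fun _ : Fin n => W.ι ≫ r) i

/-- `(Wⁿ_Y → Xⁿ_Y) ≫ prᵢ = prᵢ ≫ (W ↪ X)`. [folklore] -/
@[reassoc (attr := simp)]
theorem powOverOfOpen_proj (W : X.Opens) (i : Fin n) :
    powOverOfOpen r n W ≫ powOver.proj r n i = powOver.proj (W.ι ≫ r) n i ≫ W.ι :=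
  WidePullback.lift_π _ _ _ _ _

/-- `(Wⁿ_Y → Xⁿ_Y) ≫ (Xⁿ_Y → Y) = (Wⁿ_Y → Y)`. [folklore] -/
@[reassoc (attr := simp)]
theorem powOverOfOpen_base (W : X.Opens) :
    powOverOfOpen r n W ≫ powOver.base r n = powOver.base (W.ι ≫ r) n :=
  WidePullback.lift_base _ _ _ _

/-- `(W)ⁿ_Y → Xⁿ_Y` lands in `Wⁿ_Y`. [folklore] -/
theorem range_powOverOfOpen_subset (W : X.Opens) :
    Set.range (powOverOfOpen r n W) ⊆ (powOpen r n W : Set (powOver r n)) := by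
  rintro _ ⟨z, rfl⟩
  refine mem_powOpen.mpr fun i => ?_
  rw [← Scheme.Hom.comp_apply, powOverOfOpen_proj, Scheme.Hom.comp_apply]
  exact (powOver.proj (W.ι ≫ r) n i z).2

/-- The comparison `(W)ⁿ_Y → Wⁿ_Y`. [folklore] -/
def powOverToPowOpen (W : X.Opens) : powOver (W.ι ≫ r) n ⟶ (powOpen r n W : Scheme.{u}) :=
  IsOpenImmersion.lift (powOpen r n W).ι (powOverOfOpen r n W) (by
    rw [Scheme.Opens.range_ι]; exact range_powOverOfOpen_subset r n W)

/-- The corestriction composed with the inclusion is the induced map. [folklore] -/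
@[reassoc (attr := simp)]
theorem powOverToPowOpen_ι (W : X.Opens) :
    powOverToPowOpen r n W ≫ (powOpen r n W).ι = powOverOfOpen r n W :=
  IsOpenImmersion.lift_fac _ _ _

/-- **`Wⁿ_Y ≅ (W)ⁿ_Y`**: the open `⋂ᵢ prᵢ⁻¹ W` of `Xⁿ_Y` is the `n`-fold fibre product of `W` over
`Y`. [folklore] -/
def powOpenIso (W : X.Opens) : (powOpen r n W : Scheme.{u}) ≅ powOver (W.ι ≫ r) n where
  hom := powOpenToPowOver r n W
  inv := powOverToPowOpen r n W
  hom_inv_id := by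
    rw [← cancel_mono (powOpen r n W).ι, Category.assoc, powOverToPowOpen_ι, Category.id_comp]
    apply WidePullback.hom_ext
    · intro i
      rw [Category.assoc, powOverOfOpen_proj, powOpenToPowOver_proj_assoc, powOpenProj_ι]
    · rw [Category.assoc, powOverOfOpen_base, powOpenToPowOver_base]
  inv_hom_id := by
    apply WidePullback.hom_ext
    · intro i
      rw [Category.assoc, powOpenToPowOver_proj, Category.id_comp, ← cancel_mono W.ι, Category.assoc,
        powOpenProj_ι, powOverToPowOpen_ι_assoc, powOverOfOpen_proj]
    · rw [Category.assoc, powOpenToPowOver_base, Category.id_comp, powOverToPowOpen_ι_assoc,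
        powOverOfOpen_base]

/-- **`Wⁿ_Y → Y` is affine** when `W → Y` is. [folklore] -/
theorem isAffineHom_powOpen_ι_base (W : X.Opens) [IsAffineHom (W.ι ≫ r)] :
    IsAffineHom ((powOpen r n W).ι ≫ powOver.base r n) := by
  rw [← powOpenToPowOver_base]
  change IsAffineHom ((powOpenIso r n W).hom ≫ powOver.base (W.ι ≫ r) n)
  infer_instance

/-! ### The symmetric power of an `X → Y` whose finite subsets lie in opens affine over `Y` -/

/-- The hypothesis "every finite set of points of `X` lies in an open `W ⊆ X` affine over `Y`"
(for `Y` affine: in an affine open; e.g. `X` quasi-projective over a field). [cite: MumfordAV1970, §7 Thm. p. 66 (hypothesis) and Remark p. 69] -/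
structure FiniteSubsetsInAffineOpens : Prop where
  /-- Every finite set of points lies in an open affine over the base. -/
  exists_open : ∀ T : Finset X, ∃ W : X.Opens, IsAffineHom (W.ι ≫ r) ∧ ∀ t ∈ T, t ∈ W

variable {r n}

/-- Under `FiniteSubsetsInAffineOpens`, every point of `Xⁿ_Y` lies in an `𝔖ₙ`-stable open affine
over `Y` (namely `Wⁿ_Y` for `W ⊇` its coordinates): Mumford's hypothesis for the `𝔖ₙ`-action.
[cite: Milne1986JacobianVarieties, §3, proof of Prop. 3.2 ("we use that any finite set of points … is contained in an open affine")] -/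
theorem exists_stableAffineOpen_mem (hX : FiniteSubsetsInAffineOpens r) (z : powOver r n) :
    ∃ O : (permAction r n).StableAffineOpens, z ∈ O.1 := by
  classical
  obtain ⟨W, hW, hmem⟩ := hX.exists_open (Finset.univ.image fun i : Fin n => powOver.proj r n i z)
  haveI := hW
  refine ⟨⟨powOpen r n W, fun σ => permAction_preimage_powOpen r n σ W,
    isAffineHom_powOpen_ι_base r n W⟩, ?_⟩
  exact mem_powOpen.mpr fun i => hmem _ (Finset.mem_image_of_mem _ (Finset.mem_univ i))

variable (r n)
variable [Y.IsSeparated] [IsSeparated r] (hX : FiniteSubsetsInAffineOpens r)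

/-- **The symmetric power `X⁽ⁿ⁾_Y = Xⁿ_Y/𝔖ₙ`** of an `X → Y` (both separated) all of whose finite
subsets lie in opens affine over `Y`: the glued quotient `ActionOver.glued` of the `𝔖ₙ`-action
on `Xⁿ_Y` (Milne JV §3 Prop. 3.1 via Mumford AV §7 Thm. p. 66; for `r` affine this is
`symPow r n` up to the canonical isomorphism of categorical quotients). [cite: Milne1986JacobianVarieties, §3 Prop. 3.1] -/
def symPowGlued : Scheme.{u} := (permAction r n).glued

/-- The quotient map `Xⁿ_Y → X⁽ⁿ⁾_Y`. [cite: Milne1986JacobianVarieties, §3 Prop. 3.1] -/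
def symPowGlued.mk : powOver r n ⟶ symPowGlued r n :=
  (permAction r n).gluedMk (exists_stableAffineOpen_mem hX)

/-- `mk` is symmetric: `mk ∘ σ = mk`. [cite: Milne1986JacobianVarieties, §3 Prop. 3.1] -/
@[reassoc]
theorem permHom_symPowGlued_mk (σ : Equiv.Perm (Fin n)) :
    permHom r n σ ≫ symPowGlued.mk r n hX = symPowGlued.mk r n hX := by
  rw [← permAction_aut_hom]
  exact (permAction r n).aut_hom_gluedMk _ σ

/-- `mk` is surjective. [cite: Milne1986JacobianVarieties, §3 Prop. 3.1] -/
theorem symPowGlued.mk_surjective : Function.Surjective (symPowGlued.mk r n hX) :=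
  (permAction r n).gluedMk_surjective _

/-- `mk` is surjective (as a morphism property). [folklore] -/
instance symPowGlued.surjective_mk : Surjective (symPowGlued.mk r n hX) :=
  ⟨symPowGlued.mk_surjective r n hX⟩

/-- `mk` is affine. [folklore] -/
instance symPowGlued.isAffineHom_mk : IsAffineHom (symPowGlued.mk r n hX) :=
  (permAction r n).isAffineHom_gluedMk _

/-- **The fibres of `mk` are the `𝔖ₙ`-orbits.** [cite: Milne1986JacobianVarieties, §3 Prop. 3.1] -/
theorem symPowGlued.mk_eq_iff (x y : powOver r n) :
    symPowGlued.mk r n hX x = symPowGlued.mk r n hX y ↔ ∃ σ : Equiv.Perm (Fin n), permHom r n σ x = y := by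
  constructor
  · intro h
    obtain ⟨σ, hσ⟩ := (permAction r n).exists_aut_apply_eq_of_gluedMk_eq _ h
    exact ⟨σ, by rw [← permAction_aut_hom]; exact hσ⟩
  · rintro ⟨σ, rfl⟩
    rw [← Scheme.Hom.comp_apply, permHom_symPowGlued_mk]

/-- **Universal property of `X⁽ⁿ⁾_Y`**: symmetric morphisms `Xⁿ_Y → Z` to separated schemes factor
uniquely through `mk`. [cite: Milne1986JacobianVarieties, §3 Prop. 3.1] -/
theorem symPowGlued.existsUnique_desc {Z : Scheme.{u}} [Z.IsSeparated] (f : powOver r n ⟶ Z)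
    (hf : ∀ σ : Equiv.Perm (Fin n), permHom r n σ ≫ f = f) :
    ∃! fbar : symPowGlued r n ⟶ Z, symPowGlued.mk r n hX ≫ fbar = f :=
  (permAction r n).glued_existsUnique_desc _ f fun σ => by rw [permAction_aut_hom]; exact hf σ

/-- The factorisation of a symmetric morphism through `X⁽ⁿ⁾_Y`. [cite: Milne1986JacobianVarieties, §3 Prop. 3.1] -/
def symPowGlued.desc {Z : Scheme.{u}} [Z.IsSeparated] (f : powOver r n ⟶ Z)
    (hf : ∀ σ : Equiv.Perm (Fin n), permHom r n σ ≫ f = f) : symPowGlued r n ⟶ Z :=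
  (permAction r n).gluedDesc f fun σ => by rw [permAction_aut_hom]; exact hf σ

/-- `mk ≫ desc f = f`. [cite: Milne1986JacobianVarieties, §3 Prop. 3.1] -/
@[reassoc (attr := simp)]
theorem symPowGlued.mk_desc {Z : Scheme.{u}} [Z.IsSeparated] (f : powOver r n ⟶ Z)
    (hf : ∀ σ : Equiv.Perm (Fin n), permHom r n σ ≫ f = f) :
    symPowGlued.mk r n hX ≫ symPowGlued.desc r n f hf = f :=
  (permAction r n).gluedMk_gluedDesc _ f _

/-- Uniqueness in the universal property. [cite: Milne1986JacobianVarieties, §3 Prop. 3.1] -/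
theorem symPowGlued.hom_ext {Z : Scheme.{u}} [Z.IsSeparated] {a b : symPowGlued r n ⟶ Z}
    (h : symPowGlued.mk r n hX ≫ a = symPowGlued.mk r n hX ≫ b) : a = b :=
  (permAction r n).glued_hom_ext _ h

/-- The structure morphism `X⁽ⁿ⁾_Y → Y` (descent of the symmetric `Xⁿ_Y → Y`). [cite: Milne1986JacobianVarieties, §3 Prop. 3.1] -/
def symPowGlued.base : symPowGlued r n ⟶ Y :=
  symPowGlued.desc r n (powOver.base r n) (permHom_base r n)

/-- `mk ≫ base = Xⁿ_Y → Y`. [folklore] -/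
@[reassoc (attr := simp)]
theorem symPowGlued.mk_base : symPowGlued.mk r n hX ≫ symPowGlued.base r n = powOver.base r n :=
  symPowGlued.mk_desc r n hX _ _

include hX in
/-- **`X⁽ⁿ⁾_Y → Y` is universally closed** when `r` is (`mk` is surjective and
`mk ≫ base = Xⁿ_Y → Y` is universally closed). [cite: Milne1986JacobianVarieties, §3 Prop. 3.1] -/
theorem symPowGlued.universallyClosed_base [UniversallyClosed r] :
    UniversallyClosed (symPowGlued.base r n) := by
  haveI : UniversallyClosed (symPowGlued.mk r n hX ≫ symPowGlued.base r n) := by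
    rw [symPowGlued.mk_base]; infer_instance
  exact UniversallyClosed.of_comp_surjective (symPowGlued.mk r n hX) _

include hX in
/-- `X⁽ⁿ⁾_Y → Y` is surjective when `Xⁿ_Y → Y` is. [folklore] -/
theorem symPowGlued.surjective_base [Surjective (powOver.base r n)] :
    Surjective (symPowGlued.base r n) := by
  haveI : Surjective (symPowGlued.mk r n hX ≫ symPowGlued.base r n) := by
    rw [symPowGlued.mk_base]; infer_instance
  exact Surjective.of_comp (symPowGlued.mk r n hX) _

include hX in
/-- **`X⁽ⁿ⁾_Y → Y` is separated.** [cite: Milne1986JacobianVarieties, §3 Prop. 3.1] -/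
theorem symPowGlued.isSeparated_base : IsSeparated (symPowGlued.base r n) :=
  (permAction r n).isSeparated_gluedDesc (exists_stableAffineOpen_mem hX) _ _

include hX in
/-- `X⁽ⁿ⁾_Y` is a separated scheme. [folklore] -/
theorem symPowGlued.isSeparated : (symPowGlued r n).IsSeparated := by
  haveI := symPowGlued.isSeparated_base r n hX
  constructor
  rw [show terminal.from (symPowGlued r n) = symPowGlued.base r n ≫ terminal.from Y from
    terminal.hom_ext _ _]
  infer_instance

end Literature.AlgebraicGeometry.RelativeSpec

end
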